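import Mathlib
import Summits.KontsevichZagierPeriods.Zeta5Search.Profile4bCellsA
import Summits.KontsevichZagierPeriods.Zeta5Search.Profile4bCellsB
import Summits.KontsevichZagierPeriods.Zeta5Search.Profile3aCellsA
import Summits.KontsevichZagierPeriods.Zeta5Search.Profile3aCellsB
import Summits.KontsevichZagierPeriods.Zeta5Search.DenomLaw.Profile15aPath
import Summits.KontsevichZagierPeriods.Zeta5Search.DenomLaw.PathWeightProfile
import Summits.KontsevichZagierPeriods.Zeta5Search.DenomLaw.DoubleDropTwoKit
import HarnessLib

/-!
# ζ(5) search — the `N_p = 4` PROFILE 4b AND the `N_p = 3` PROFILE 3a of the first period for EVERY sorted parameter vector: PATH accounting at every depth by the double drop at depth two (DENOM-LAW D1, prover-d1 gen 23)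

Cell `pub-zeta5` (HONEST FRAMING: systematic search; no irrationality claim unless certified), TRACK «DENOM-LAW» D1 prover seat (denom-prover-d1
gen 23, `HOME/denom-law/prover-d1/ATTEMPT-23.md`).  The LAST two of the 64 a = 7 profiles (the 2⁶ up-sets of the pair poset): 4b, long pair blocks
exactly `(4,7),(5,6),(5,7),(6,7)` — ORDER conditions `b₀ < p + b₃ + b₇`, `b₀ < p + b₄ + b₆`, `p + b₄ + b₇ ≤ b₀`, `p + b₅ + b₆ ≤ b₀` —, and 3a, long
exactly `(5,6),(5,7),(6,7)` — `b₀ < p + b₄ + b₇`, `p + b₅ + b₆ ≤ b₀`.  On both `d < 2p` and the node `⌊d/p⌋ − N_p − min(0, 5 − C⋆)` asks `−1` at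
`d < p` and `0` at `p ≤ d` (`C⋆ ≤ 8` resp. `≤ 7`, new finite checks here).  gen 22 left them open (ATTEMPT-22 §4 (2)): in 2,383 of their 6,231 instances
at p = 7, 11 the deepest class is a centre-free `[1,−2,−2,1]` (exponent `−2`), THEOREM LB stops at `−2 / −1`, and the census reaches the node only by
its instance-level «V-GAIN» rung.  That rung is, in cover form, THE DOUBLE DROP AT DEPTH TWO (`DenomLaw/DoubleDropTwoKit`, gen 23: gen-2 g9's
double-drop transport at `N = 2` — `‖V(b)‖, ‖V(b+e_j)‖ ≤ p` because the deep classes cancel in conjugate pairs, no cover of `b + e_j` needed — with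
THEOREM LB's rows): `v_p(Cas_j(b)) ≥ −1 + [p ≤ d]`, i.e. EXACTLY the node, on the WHOLE profile (gen 10's `checkB` at `N = 2` is `decide`d on the
whole type lists of the machine-generated covers `FullProfile.cover4b/3a_ev/od`, `Profile{4b,3a}Cells{A,B}`, every leaf lemma reused).  p-uniform
hypotheses: the node's binders, `p ≤ b₇`, the pair-block ORDER conditions.  Results: `pathAccounting_profile4b/3a` (every `j`) and
**`pathAccountingFirstPeriod_profile4b/3a`**.  With this file and gen 22/23's profile files every one of the 64 a = 7 profiles carries a node theorem.
Census beside the proof (gen 22/23 classifier, exhaustive a = 7 at p = 7, 11, 13): 4b 5,581 · 3a 18,206 instances, reached by LB (3,484 · 10,962) or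
VG (2,097 · 7,244) — both now instances of `cas_ge4b` / `cas_ge3a`; 0 open at p ≤ 13 (kit j285126).  MODEL/structure-side valuation bookkeeping of
the cell's own rationals; nothing about ζ(5); no γ; records in print UNMOVED.
-/

open Finset

namespace Summit.KontsevichZagierPeriods.Zeta5Search.FullProfile

open Summit.KontsevichZagierPeriods.Zeta5Search.ClusterValuation
open Summit.KontsevichZagierPeriods.Zeta5Search.CasoratianValuation (InPolytope shift casoratian pairFloors refund)
open Summit.KontsevichZagierPeriods.Zeta5Search.WedgeDictionary (dOf)
open Summit.KontsevichZagierPeriods.Zeta5Search.ClassTypeCover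
open Summit.KontsevichZagierPeriods.Zeta5Search.DenomLaw (cStar FirstPeriod Sorted7 doubleDropTwo_of_cover)
open Summit.KontsevichZagierPeriods.Zeta5Search.DenomLaw.FirstPeriodKit (sorted7_chain firstPeriod_pair pairFloors_expand)
open Summit.KontsevichZagierPeriods.Zeta5Search.SortedProfile

/-! ## Path-weight bounds on 4b and 3a -/

/-- **`C⋆ ≤ 8` on 4b** (long blocks `(4,7),(5,6),(5,7),(6,7)` only — a Hamiltonian path meets at most three of them): the finite check over the
5,040 orderings (`decide +kernel`). -/
theorem cStar_le_eight_4b {b : ℕ → ℤ} {p : ℕ} (hs : Sorted7 b) (hQ : b 0 < (p : ℤ) + b 3 + b 7) (hQ46 : b 0 < (p : ℤ) + b 4 + b 6) : cStar b p ≤ 8 := by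
  obtain ⟨h21, h32, h43, h54, h65, h76⟩ := sorted7_chain hs
  refine DenomLaw.FirstPeriodKit.cStar_le_of_profile (fun _ => True)
    (fun i k => ¬ ((i.val ≤ 2 ∨ k.val ≤ 2 ∨ (i.val = 3 ∧ k.val ≤ 5) ∨ (k.val = 3 ∧ i.val ≤ 5)) ∧ i.val ≠ k.val)) 8
    (fun _ _ => trivial) ?_ (by decide +kernel)
  intro i k hik h
  obtain ⟨h, hne⟩ := h
  have := i.isLt; have := k.isLt
  exfalso
  rcases h with hi | hk | ⟨hi, hk⟩ | ⟨hk, hi⟩ <;> interval_cases hv : i.val <;> interval_cases hw : k.val <;> simp only [Nat.reduceAdd] at hik <;> omega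

/-- **`C⋆ ≤ 7` on 3a** (long blocks: the triangle on `{5,6,7}` — a Hamiltonian path meets at most two of its edges). -/
theorem cStar_le_seven_3a {b : ℕ → ℤ} {p : ℕ} (hs : Sorted7 b) (hQ : b 0 < (p : ℤ) + b 4 + b 7) : cStar b p ≤ 7 := by
  obtain ⟨h21, h32, h43, h54, h65, h76⟩ := sorted7_chain hs
  refine DenomLaw.FirstPeriodKit.cStar_le_of_profile (fun _ => True)
    (fun i k => ¬ ((i.val ≤ 3 ∨ k.val ≤ 3) ∧ i.val ≠ k.val)) 7
    (fun _ _ => trivial) ?_ (by decide +kernel)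
  intro i k hik h
  obtain ⟨h, hne⟩ := h
  have := i.isLt; have := k.isLt
  exfalso
  rcases h with hi | hk <;> interval_cases hv : i.val <;> interval_cases hw : k.val <;> simp only [Nat.reduceAdd] at hik <;> omega

/-! ## The `N_p = 4` profile with short blocks all but `(4,7),(5,6),(5,7),(6,7)` -/

section P4B

variable {b : ℕ → ℤ} {j p : ℕ}

/-- **`N_p = 4`** on this profile: the pair digits of the 17 short blocks are `0`, the other 4 are `1`. -/
theorem pairFloors_eq_4b (hb : InPolytope b) (hs : Sorted7 b) (hp : 0 < p) (hQ : b 0 < (p : ℤ) + b 3 + b 7) (hQ46 : b 0 < (p : ℤ) + b 4 + b 6) (hQ47 : (p : ℤ) + b 4 + b 7 ≤ b 0) (hQ56 : (p : ℤ) + b 5 + b 6 ≤ b 0) (hfp : FirstPeriod b p) : pairFloors b p = 4 := by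
  obtain ⟨h21, h32, h43, h54, h65, h76⟩ := sorted7_chain hs
  obtain ⟨h0, hb1, hb2, hb3, hb4, hb5, hb6, hb7, hc1⟩ := box hb
  have hp0 : (0 : ℤ) < p := by exact_mod_cast hp
  have one : ∀ z : ℤ, (p : ℤ) ≤ z → z ≤ 2 * (p : ℤ) - 1 → z / (p : ℤ) = 1 := fun z h1 h2 => by
    rw [Int.ediv_eq_iff_of_pos hp0]; constructor <;> linarith
  have z12 : (b 0 - b 1 - b 2) / (p : ℤ) = 0 := Int.ediv_eq_zero_of_lt (by linarith) (by linarith)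
  have z13 : (b 0 - b 1 - b 3) / (p : ℤ) = 0 := Int.ediv_eq_zero_of_lt (by linarith) (by linarith)
  have z14 : (b 0 - b 1 - b 4) / (p : ℤ) = 0 := Int.ediv_eq_zero_of_lt (by linarith) (by linarith)
  have z15 : (b 0 - b 1 - b 5) / (p : ℤ) = 0 := Int.ediv_eq_zero_of_lt (by linarith) (by linarith)
  have z16 : (b 0 - b 1 - b 6) / (p : ℤ) = 0 := Int.ediv_eq_zero_of_lt (by linarith) (by linarith)
  have z17 : (b 0 - b 1 - b 7) / (p : ℤ) = 0 := Int.ediv_eq_zero_of_lt (by linarith) (by linarith)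
  have z23 : (b 0 - b 2 - b 3) / (p : ℤ) = 0 := Int.ediv_eq_zero_of_lt (by linarith) (by linarith)
  have z24 : (b 0 - b 2 - b 4) / (p : ℤ) = 0 := Int.ediv_eq_zero_of_lt (by linarith) (by linarith)
  have z25 : (b 0 - b 2 - b 5) / (p : ℤ) = 0 := Int.ediv_eq_zero_of_lt (by linarith) (by linarith)
  have z26 : (b 0 - b 2 - b 6) / (p : ℤ) = 0 := Int.ediv_eq_zero_of_lt (by linarith) (by linarith)
  have z27 : (b 0 - b 2 - b 7) / (p : ℤ) = 0 := Int.ediv_eq_zero_of_lt (by linarith) (by linarith)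
  have z34 : (b 0 - b 3 - b 4) / (p : ℤ) = 0 := Int.ediv_eq_zero_of_lt (by linarith) (by linarith)
  have z35 : (b 0 - b 3 - b 5) / (p : ℤ) = 0 := Int.ediv_eq_zero_of_lt (by linarith) (by linarith)
  have z36 : (b 0 - b 3 - b 6) / (p : ℤ) = 0 := Int.ediv_eq_zero_of_lt (by linarith) (by linarith)
  have z37 : (b 0 - b 3 - b 7) / (p : ℤ) = 0 := Int.ediv_eq_zero_of_lt (by linarith) (by linarith)
  have z45 : (b 0 - b 4 - b 5) / (p : ℤ) = 0 := Int.ediv_eq_zero_of_lt (by linarith) (by linarith)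
  have z46 : (b 0 - b 4 - b 6) / (p : ℤ) = 0 := Int.ediv_eq_zero_of_lt (by linarith) (by linarith)
  have U := fun (i k : ℕ) (hi : i < 7) (hk : k < 7) (hik : i < k) => firstPeriod_pair hfp hi hk hik
  rw [pairFloors_expand, z12, z13, z14, z15, z16, z17, z23, z24, z25, z26, z27, z34, z35, z36, z37, z45, z46,
    one _ (by linarith) (U 3 6 (by norm_num) (by norm_num) (by norm_num)),
    one _ (by linarith) (U 4 5 (by norm_num) (by norm_num) (by norm_num)),
    one _ (by linarith) (U 4 6 (by norm_num) (by norm_num) (by norm_num)),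
    one _ (by linarith) (U 5 6 (by norm_num) (by norm_num) (by norm_num))]
  norm_num

/-- **The DOUBLE DROP AT DEPTH TWO on this profile, general `b`, every depth**: `v_p(Cas_j(b)) ≥ −1`, and `≥ 0` for `p ≤ d` — gen 10's
`checkB` at `N = 2` holds on both covers (the only non-tame classes of exponent `≤ −2` are the centre-free palindromes `[1,−2,−2,1]` at `−2`), so
gen 23's `DenomLaw.doubleDropTwo_of_cover` applies (`‖V(b)‖, ‖V(b+e_j)‖ ≤ p` by pairwise cancellation of the deep conjugate pairs, THEOREM LB's
rows with these constant terms).  This is the census's V-GAIN rung in cover form; where no `[1,−2,−2,1]` is realised it is THEOREM LB's value. -/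
theorem cas_ge4b (hb : InPolytope b) (hs : Sorted7 b) (hbj : InPolytope (shift b j)) (hj1 : 1 ≤ j) (hj7 : j ≤ 7)
    (hprime : p.Prime) (hp5 : 5 ≤ p) (hwin : (b 0 + 2 : ℤ) < (p : ℤ) ^ 2) (hP : (p : ℤ) ≤ b 7) (hQ : b 0 < (p : ℤ) + b 3 + b 7) (hQ46 : b 0 < (p : ℤ) + b 4 + b 6) (hQ47 : (p : ℤ) + b 4 + b 7 ≤ b 0) (hQ56 : (p : ℤ) + b 5 + b 6 ≤ b 0)
    (hF1 : b 1 < 2 * (p : ℤ)) (hF2 : b 0 < 2 * (p : ℤ) + b 6 + b 7) (hcas : casoratian b j ≠ 0) :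
    -1 + (if (p : ℤ) ≤ dOf b then (1 : ℤ) else 0) ≤ padicValRat p (casoratian b j) := by
  haveI : Fact p.Prime := ⟨hprime⟩
  have hp2 : p % 2 = 1 := Nat.odd_iff.1 (hprime.odd_of_ne_two (by omega))
  obtain ⟨h21, h32, h43, h54, h65, h76⟩ := sorted7_chain hs
  have hpb : (p : ℤ) ≤ b 0 := by linarith
  rcases Int.emod_two_eq_zero_or_one (b 0) with hr | hr
  · exact doubleDropTwo_of_cover hb hj1 hj7 hbj hp5 hpb hwin (cover4b_ev hb hs hP hQ hQ46 hQ47 hQ56 hF1 hF2 hp5 hp2 hr) (by rw [oddFlag_false hr]; decide) hcas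
  · exact doubleDropTwo_of_cover hb hj1 hj7 hbj hp5 hpb hwin (cover4b_od hb hs hP hQ hQ46 hQ47 hQ56 hF1 hF2 hp5 hp2 hr) (by rw [oddFlag_true hr]; decide) hcas

/-- On this profile `d(b) < 2p`. -/
theorem d_lt_two4b (hs : Sorted7 b) (hP : (p : ℤ) ≤ b 7) (hQ : b 0 < (p : ℤ) + b 3 + b 7) (_hQ46 : b 0 < (p : ℤ) + b 4 + b 6) (_hQ47 : (p : ℤ) + b 4 + b 7 ≤ b 0) (_hQ56 : (p : ℤ) + b 5 + b 6 ≤ b 0) : dOf b < 2 * (p : ℤ) := by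
  obtain ⟨h21, h32, h43, h54, h65, h76⟩ := sorted7_chain hs
  rw [DecompositionWholeCone.dOf_expand]; linarith

/-- **`PathAccountingFirstPeriod`'s conclusion on this `N_p = 4` profile (short blocks all but `(4,7),(5,6),(5,7),(6,7)`), EVERY sorted `b`, every direction `j`, every depth**
(`C⋆ ≤ 8`; `d < 2p`; the node asks `-1` at `⌊d/p⌋ = 0` and `0` at `⌊d/p⌋ = 1`). -/
theorem pathAccounting_profile4b (b : ℕ → ℤ) (j p : ℕ) (hb : InPolytope b) (hs : Sorted7 b) (hbj : InPolytope (shift b j))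
    (hj1 : 1 ≤ j) (hj7 : j ≤ 7) (hprime : p.Prime) (hp5 : 5 ≤ p) (hwin : (b 0 + 2 : ℤ) < (p : ℤ) ^ 2) (hfp : FirstPeriod b p)
    (hP : (p : ℤ) ≤ b 7) (hQ : b 0 < (p : ℤ) + b 3 + b 7) (hQ46 : b 0 < (p : ℤ) + b 4 + b 6) (hQ47 : (p : ℤ) + b 4 + b 7 ≤ b 0) (hQ56 : (p : ℤ) + b 5 + b 6 ≤ b 0)
    (hcas : casoratian b j ≠ 0) :
    dOf b / (p : ℤ) - pairFloors b p - min (if 2 ≤ dOf b / (p : ℤ) then (1 : ℤ) else 0) (5 - (cStar b p : ℤ))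
      ≤ padicValRat p (casoratian b j) := by
  obtain ⟨hF1, hF2⟩ := fp_bounds hfp
  have hp0 : (0 : ℤ) < p := by exact_mod_cast hprime.pos
  rw [pairFloors_eq_4b hb hs hprime.pos hQ hQ46 hQ47 hQ56 hfp]
  have hC : (cStar b p : ℤ) ≤ 8 := by exact_mod_cast cStar_le_eight_4b hs hQ hQ46
  have hfd : dOf b / (p : ℤ) < 2 := by rw [Int.ediv_lt_iff_lt_mul hp0]; linarith [d_lt_two4b hs hP hQ hQ46 hQ47 hQ56]
  rw [if_neg (by omega)]
  have hmin : -3 ≤ min (0 : ℤ) (5 - (cStar b p : ℤ)) := le_min (by norm_num) (by linarith)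
  have hlaw := cas_ge4b hb hs hbj hj1 hj7 hprime hp5 hwin hP hQ hQ46 hQ47 hQ56 hF1 hF2 hcas
  by_cases h1 : (p : ℤ) ≤ dOf b
  · have hfd1 : dOf b / (p : ℤ) ≤ 1 := by omega
    rw [if_pos h1] at hlaw
    linarith
  · rw [if_neg h1] at hlaw
    push Not at h1
    have hd0 : 0 ≤ dOf b := by have := hb.2.2; unfold dOf; linarith
    have hfd0 : dOf b / (p : ℤ) = 0 := Int.ediv_eq_zero_of_lt hd0 h1
    rw [hfd0]
    linarith

/-- **THE NODE ON THIS `N_p = 4` PROFILE, EVERY SORTED `b`, EVERY DEPTH: `PathAccountingFirstPeriod` with its binders VERBATIM plus `p ≤ b₇` and the profile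
inequalities.** -/
theorem pathAccountingFirstPeriod_profile4b :
    ∀ (b : ℕ → ℤ) (p : ℕ), InPolytope b → Sorted7 b → InPolytope (shift b 7) →
      p.Prime → 5 ≤ p → (b 0 + 2 : ℤ) < (p : ℤ) ^ 2 → FirstPeriod b p →
      (p : ℤ) ≤ b 7 → b 0 < (p : ℤ) + b 3 + b 7 → b 0 < (p : ℤ) + b 4 + b 6 → (p : ℤ) + b 4 + b 7 ≤ b 0 → (p : ℤ) + b 5 + b 6 ≤ b 0 → casoratian b 7 ≠ 0 →
        dOf b / (p : ℤ) - pairFloors b p - min (if 2 ≤ dOf b / (p : ℤ) then (1 : ℤ) else 0) (5 - (cStar b p : ℤ))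
          ≤ padicValRat p (casoratian b 7) :=
  fun b p hb hs hb7 hprime hp5 hwin hfp hP hQ hQ46 hQ47 hQ56 hcas =>
    pathAccounting_profile4b b 7 p hb hs hb7 (by norm_num) (by norm_num) hprime hp5 hwin hfp hP hQ hQ46 hQ47 hQ56 hcas

end P4B

/-! ## The `N_p = 3` profile with short blocks all but `(5,6),(5,7),(6,7)` -/

section P3A

variable {b : ℕ → ℤ} {j p : ℕ}

/-- **`N_p = 3`** on this profile: the pair digits of the 18 short blocks are `0`, the other 3 are `1`. -/
theorem pairFloors_eq_3a (hb : InPolytope b) (hs : Sorted7 b) (hp : 0 < p) (hQ : b 0 < (p : ℤ) + b 4 + b 7) (hQ56 : (p : ℤ) + b 5 + b 6 ≤ b 0) (hfp : FirstPeriod b p) : pairFloors b p = 3 := by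
  obtain ⟨h21, h32, h43, h54, h65, h76⟩ := sorted7_chain hs
  obtain ⟨h0, hb1, hb2, hb3, hb4, hb5, hb6, hb7, hc1⟩ := box hb
  have hp0 : (0 : ℤ) < p := by exact_mod_cast hp
  have one : ∀ z : ℤ, (p : ℤ) ≤ z → z ≤ 2 * (p : ℤ) - 1 → z / (p : ℤ) = 1 := fun z h1 h2 => by
    rw [Int.ediv_eq_iff_of_pos hp0]; constructor <;> linarith
  have z12 : (b 0 - b 1 - b 2) / (p : ℤ) = 0 := Int.ediv_eq_zero_of_lt (by linarith) (by linarith)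
  have z13 : (b 0 - b 1 - b 3) / (p : ℤ) = 0 := Int.ediv_eq_zero_of_lt (by linarith) (by linarith)
  have z14 : (b 0 - b 1 - b 4) / (p : ℤ) = 0 := Int.ediv_eq_zero_of_lt (by linarith) (by linarith)
  have z15 : (b 0 - b 1 - b 5) / (p : ℤ) = 0 := Int.ediv_eq_zero_of_lt (by linarith) (by linarith)
  have z16 : (b 0 - b 1 - b 6) / (p : ℤ) = 0 := Int.ediv_eq_zero_of_lt (by linarith) (by linarith)
  have z17 : (b 0 - b 1 - b 7) / (p : ℤ) = 0 := Int.ediv_eq_zero_of_lt (by linarith) (by linarith)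
  have z23 : (b 0 - b 2 - b 3) / (p : ℤ) = 0 := Int.ediv_eq_zero_of_lt (by linarith) (by linarith)
  have z24 : (b 0 - b 2 - b 4) / (p : ℤ) = 0 := Int.ediv_eq_zero_of_lt (by linarith) (by linarith)
  have z25 : (b 0 - b 2 - b 5) / (p : ℤ) = 0 := Int.ediv_eq_zero_of_lt (by linarith) (by linarith)
  have z26 : (b 0 - b 2 - b 6) / (p : ℤ) = 0 := Int.ediv_eq_zero_of_lt (by linarith) (by linarith)
  have z27 : (b 0 - b 2 - b 7) / (p : ℤ) = 0 := Int.ediv_eq_zero_of_lt (by linarith) (by linarith)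
  have z34 : (b 0 - b 3 - b 4) / (p : ℤ) = 0 := Int.ediv_eq_zero_of_lt (by linarith) (by linarith)
  have z35 : (b 0 - b 3 - b 5) / (p : ℤ) = 0 := Int.ediv_eq_zero_of_lt (by linarith) (by linarith)
  have z36 : (b 0 - b 3 - b 6) / (p : ℤ) = 0 := Int.ediv_eq_zero_of_lt (by linarith) (by linarith)
  have z37 : (b 0 - b 3 - b 7) / (p : ℤ) = 0 := Int.ediv_eq_zero_of_lt (by linarith) (by linarith)
  have z45 : (b 0 - b 4 - b 5) / (p : ℤ) = 0 := Int.ediv_eq_zero_of_lt (by linarith) (by linarith)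
  have z46 : (b 0 - b 4 - b 6) / (p : ℤ) = 0 := Int.ediv_eq_zero_of_lt (by linarith) (by linarith)
  have z47 : (b 0 - b 4 - b 7) / (p : ℤ) = 0 := Int.ediv_eq_zero_of_lt (by linarith) (by linarith)
  have U := fun (i k : ℕ) (hi : i < 7) (hk : k < 7) (hik : i < k) => firstPeriod_pair hfp hi hk hik
  rw [pairFloors_expand, z12, z13, z14, z15, z16, z17, z23, z24, z25, z26, z27, z34, z35, z36, z37, z45, z46, z47,
    one _ (by linarith) (U 4 5 (by norm_num) (by norm_num) (by norm_num)),
    one _ (by linarith) (U 4 6 (by norm_num) (by norm_num) (by norm_num)),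
    one _ (by linarith) (U 5 6 (by norm_num) (by norm_num) (by norm_num))]
  norm_num

/-- **The DOUBLE DROP AT DEPTH TWO on this profile, general `b`, every depth**: `v_p(Cas_j(b)) ≥ −1`, and `≥ 0` for `p ≤ d` — gen 10's
`checkB` at `N = 2` holds on both covers (the only non-tame classes of exponent `≤ −2` are the centre-free palindromes `[1,−2,−2,1]` at `−2`), so
gen 23's `DenomLaw.doubleDropTwo_of_cover` applies (`‖V(b)‖, ‖V(b+e_j)‖ ≤ p` by pairwise cancellation of the deep conjugate pairs, THEOREM LB's
rows with these constant terms).  This is the census's V-GAIN rung in cover form; where no `[1,−2,−2,1]` is realised it is THEOREM LB's value. -/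
theorem cas_ge3a (hb : InPolytope b) (hs : Sorted7 b) (hbj : InPolytope (shift b j)) (hj1 : 1 ≤ j) (hj7 : j ≤ 7)
    (hprime : p.Prime) (hp5 : 5 ≤ p) (hwin : (b 0 + 2 : ℤ) < (p : ℤ) ^ 2) (hP : (p : ℤ) ≤ b 7) (hQ : b 0 < (p : ℤ) + b 4 + b 7) (hQ56 : (p : ℤ) + b 5 + b 6 ≤ b 0)
    (hF1 : b 1 < 2 * (p : ℤ)) (hF2 : b 0 < 2 * (p : ℤ) + b 6 + b 7) (hcas : casoratian b j ≠ 0) :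
    -1 + (if (p : ℤ) ≤ dOf b then (1 : ℤ) else 0) ≤ padicValRat p (casoratian b j) := by
  haveI : Fact p.Prime := ⟨hprime⟩
  have hp2 : p % 2 = 1 := Nat.odd_iff.1 (hprime.odd_of_ne_two (by omega))
  obtain ⟨h21, h32, h43, h54, h65, h76⟩ := sorted7_chain hs
  have hpb : (p : ℤ) ≤ b 0 := by linarith
  rcases Int.emod_two_eq_zero_or_one (b 0) with hr | hr
  · exact doubleDropTwo_of_cover hb hj1 hj7 hbj hp5 hpb hwin (cover3a_ev hb hs hP hQ hQ56 hF1 hF2 hp5 hp2 hr) (by rw [oddFlag_false hr]; decide) hcas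
  · exact doubleDropTwo_of_cover hb hj1 hj7 hbj hp5 hpb hwin (cover3a_od hb hs hP hQ hQ56 hF1 hF2 hp5 hp2 hr) (by rw [oddFlag_true hr]; decide) hcas

/-- On this profile `d(b) < 2p`. -/
theorem d_lt_two3a (hs : Sorted7 b) (hP : (p : ℤ) ≤ b 7) (hQ : b 0 < (p : ℤ) + b 4 + b 7) (_hQ56 : (p : ℤ) + b 5 + b 6 ≤ b 0) : dOf b < 2 * (p : ℤ) := by
  obtain ⟨h21, h32, h43, h54, h65, h76⟩ := sorted7_chain hs
  rw [DecompositionWholeCone.dOf_expand]; linarith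

/-- **`PathAccountingFirstPeriod`'s conclusion on this `N_p = 3` profile (short blocks all but `(5,6),(5,7),(6,7)`), EVERY sorted `b`, every direction `j`, every depth**
(`C⋆ ≤ 7`; `d < 2p`; the node asks `-1` at `⌊d/p⌋ = 0` and `0` at `⌊d/p⌋ = 1`). -/
theorem pathAccounting_profile3a (b : ℕ → ℤ) (j p : ℕ) (hb : InPolytope b) (hs : Sorted7 b) (hbj : InPolytope (shift b j))
    (hj1 : 1 ≤ j) (hj7 : j ≤ 7) (hprime : p.Prime) (hp5 : 5 ≤ p) (hwin : (b 0 + 2 : ℤ) < (p : ℤ) ^ 2) (hfp : FirstPeriod b p)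
    (hP : (p : ℤ) ≤ b 7) (hQ : b 0 < (p : ℤ) + b 4 + b 7) (hQ56 : (p : ℤ) + b 5 + b 6 ≤ b 0)
    (hcas : casoratian b j ≠ 0) :
    dOf b / (p : ℤ) - pairFloors b p - min (if 2 ≤ dOf b / (p : ℤ) then (1 : ℤ) else 0) (5 - (cStar b p : ℤ))
      ≤ padicValRat p (casoratian b j) := by
  obtain ⟨hF1, hF2⟩ := fp_bounds hfp
  have hp0 : (0 : ℤ) < p := by exact_mod_cast hprime.pos
  rw [pairFloors_eq_3a hb hs hprime.pos hQ hQ56 hfp]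
  have hC : (cStar b p : ℤ) ≤ 7 := by exact_mod_cast cStar_le_seven_3a hs hQ
  have hfd : dOf b / (p : ℤ) < 2 := by rw [Int.ediv_lt_iff_lt_mul hp0]; linarith [d_lt_two3a hs hP hQ hQ56]
  rw [if_neg (by omega)]
  have hmin : -2 ≤ min (0 : ℤ) (5 - (cStar b p : ℤ)) := le_min (by norm_num) (by linarith)
  have hlaw := cas_ge3a hb hs hbj hj1 hj7 hprime hp5 hwin hP hQ hQ56 hF1 hF2 hcas
  by_cases h1 : (p : ℤ) ≤ dOf b
  · have hfd1 : dOf b / (p : ℤ) ≤ 1 := by omega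
    rw [if_pos h1] at hlaw
    linarith
  · rw [if_neg h1] at hlaw
    push Not at h1
    have hd0 : 0 ≤ dOf b := by have := hb.2.2; unfold dOf; linarith
    have hfd0 : dOf b / (p : ℤ) = 0 := Int.ediv_eq_zero_of_lt hd0 h1
    rw [hfd0]
    linarith

/-- **THE NODE ON THIS `N_p = 3` PROFILE, EVERY SORTED `b`, EVERY DEPTH: `PathAccountingFirstPeriod` with its binders VERBATIM plus `p ≤ b₇` and the profile
inequalities.** -/
theorem pathAccountingFirstPeriod_profile3a :
    ∀ (b : ℕ → ℤ) (p : ℕ), InPolytope b → Sorted7 b → InPolytope (shift b 7) →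
      p.Prime → 5 ≤ p → (b 0 + 2 : ℤ) < (p : ℤ) ^ 2 → FirstPeriod b p →
      (p : ℤ) ≤ b 7 → b 0 < (p : ℤ) + b 4 + b 7 → (p : ℤ) + b 5 + b 6 ≤ b 0 → casoratian b 7 ≠ 0 →
        dOf b / (p : ℤ) - pairFloors b p - min (if 2 ≤ dOf b / (p : ℤ) then (1 : ℤ) else 0) (5 - (cStar b p : ℤ))
          ≤ padicValRat p (casoratian b 7) :=
  fun b p hb hs hb7 hprime hp5 hwin hfp hP hQ hQ56 hcas =>
    pathAccounting_profile3a b 7 p hb hs hb7 (by norm_num) (by norm_num) hprime hp5 hwin hfp hP hQ hQ56 hcas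

end P3A

end Summit.KontsevichZagierPeriods.Zeta5Search.FullProfile
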